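import Literature.MathematicalPhysics.QuantumFieldTheory.Balaban1983to89.B6SectAScalarModelV1

/-!
# `Balaban1983to89.B6Eq217ScalarModelV1` — T. Bałaban, *Propagators and renormalization transformations for lattice gauge
# theories. II*, Commun. Math. Phys. **96** (1984) 223–250 [Balaban1984PropagatorsII], Sect. A p. 225 ON THE V1
# MULTI-LEVEL TORUS CALCULUS, THE SCALAR SIDE, file 2/2: the Lagrange chain (2.15)–(2.16) and **(2.17)
# `R = I − G′Q′*(Q′G′²Q′*)⁻¹Q′G′` PROVED for the CONCRETE orthogonal projection `R` onto `ΔN(Q′)`** of `…B6SectAOperatorsV1`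
# (gen 5), with the `G′ = Δ′_a⁻¹`, `(Q′G′²Q′*)⁻¹` CONSTRUCTED in file 1/2 `…B6SectAScalarModelV1` — every nested family of
# domains, every lattice factor `c ≠ 0`, every weight `a > 0`; riding: (2.13)/(2.12) (the minimum of (2.13) on `N(Q′)` exists,
# is unique, is the printed `λ`, and `Rf = Δλ = Δ′_aλ`) and (2.26)–(2.27) `R = Δ𝒢Δ`, `Q′𝒢 = 𝒢Q′* = 0`

statement-level skeleton of published theorems with citation tags; proofs where landed; nothing here is a claim about the
Yang–Mills mass gap

PDF held: `paper:balaban1984-cmp96-propagators-rt-ii` (journal page = PDF page + 222); p. 225 read AS IMAGE on the ×2 render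
`run/shared/lean/pub/pub-balaban/b2b-balaban-ref1/pages/1984-cmp96-propagators-rt-II/…-p003-x2.png` (this seat, 2026-08-21),
pp. 226–227 on `…-p004/p005-x2.png`.

CITATION HEADER (lean-in-tree rule).  Cell `lit-balaban` (HOME `run/shared/lean/pub/lit-balaban/`), PHASE-2 proof seat **p21**
(gen 6), B6 fold owner r03, referee ref-4.  WHAT IS REPRODUCED: SKELETON rows **B6.Eq2.17** ((2.15)–(2.17)), **B6.Eq2.8** /
**B6.Eq2.12** / **B6.Eq2.13** (the minimum of (2.13) on `N(Q′)`: exists, unique, `Rf = Δλ = Δ′_aλ`), **B6.Eq2.27** ((2.26)–(2.27))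
— KIND model instance: the abstract theorems of record are r03's `…B6SectA` (p238845) `starProjection_eq_repr217`,
`norm_sub_repr217_le`, `deltaPrime_apply_of_mem_ker`, `map_deltaPrime_ker_eq`, `deltaPrime_calG_deltaPrime`,
`conj_calG_eq_lap_calG_lap`, `comp_tildeOp_eq_zero`/`tildeOp_comp_eq_zero`, `inner_calG_comm`, whose inverses `G′`,
`(Q′G′²Q′*)⁻¹`, symmetry/adjointness facts and analytic input (2.11) are hypotheses there; here EVERY hypothesis is discharged
for the multi-level operators `Δ = lapE`, `Q′ = QpE`, `Q′* = QpsE`, `R = RE` of `…B6SectAOperatorsV1` with file 1's `GpE`, `CpE`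
(the companion on r03's `…B6Eq211.BlockSystem` carrier is this seat's gen-2 `…B6Eq217BlockSystem.eq217/eq213/eq227`).  Inputs
BY NAME: file 1; gen 5's `…B6SectAZeroModesV1.laplace_injOn_gaugeSpace` ((2.11) qualitative: uniqueness of the minimum),
`…B6SectAOperatorsV1.{RE_apply, RE_range, RE_mem, KE, inner_QpsE_left, mem_ker_QpE_iff, ofLp_lapE}`.  Nothing of the abstract
files is restated.

PRINT (p. 225, verbatim).  *"According to the definition a value Rf of the operator R acting on a function f defined on T_η is
equal to Δλ, where λ is a minimum of the functional λ ∈ N(Q′), λ → Σ_x η^d|f(x) − (Δλ)(x)|² = Σ_x η^d|f(x) − (Δ′_aλ)(x)|², (2.13)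
… To find this minimum we consider the function g(λ, ω) = ½Σ_x η^d|f(x) − (Δ′_aλ)(x)|² + ⟨ω, Q′λ⟩, (2.15) where ⟨ω, Q′λ⟩ =
Σ_{j=0}^k Σ_{y∈Λ_j} (L^jη)^d ω(y)(Q′_jλ)(y). Extremal points of this function are given by solutions of the equations δg/δλ =
−Δ′_a(f − Δ′_aλ) + Q′*ω = 0, δg/δω = Q′λ = 0. (2.16) The first equation gives λ = Δ′_a⁻¹f − Δ′_a⁻²Q′*ω = G′f − G′²Q′*ω, from
the second we get Q′λ = Q′G′f − Q′G′²Q′*ω = 0, hence ω = (Q′G′²Q′*)⁻¹Q′G′f and λ = G′f − G′²Q′*(Q′G′²Q′*)⁻¹Q′G′f. Of course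
Q′λ = 0, hence Rf = Δλ = Δ′_aλ = f − G′Q′*(Q′G′²Q′*)⁻¹Q′G′f. (2.17)"*; p. 227: *"Thus we have R = Δ𝒢Δ. (2.26) It is easy to see
that 𝒢 = G′² − G′²Q′*(Q′G′²Q′*)⁻¹Q′G′². (2.27) This formula, the equality (2.26) and the equalities Q′𝒢 = 𝒢Q′* = 0 imply the
representation (2.17)."*

WHAT IS PROVED (0 sorry, 0 new named facts; axioms standard; every `D : Domains P`, `c ≠ 0`, weights `w > 0` on `𝔅`; ℓ²
pairings).  §3 **the Lagrange chain (2.15)–(2.16)**: `g` (2.15) (`g215`) and its exact expansions in `λ` and `ω` whose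
first-order coefficients are the printed `δg/δλ`, `δg/δω` (`g215_add_lam`, `g215_add_omega`, `eq216_iff_stationary`); the
extremal equations (2.16) (`Eq216`) have EXACTLY ONE solution `(λ, ω)`, namely `ω = (Q′G′²Q′*)⁻¹Q′G′f` (`omega216`),
`λ = G′f − G′²Q′*(Q′G′²Q′*)⁻¹Q′G′f` (`lam216`) (`eq216_iff`, `existsUnique_eq216`, following the printed two sentences), *"Of course
Q′λ = 0"* (`QpE_lam216`), `Δ′_aλ = f − G′Q′*(Q′G′²Q′*)⁻¹Q′G′f` (`deltaPE_lam216`).  §4 **(2.17) `eq217_V1`/`eq217_op_V1`: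
`RE D c = B6SectA.repr217 G′ Q′ Q′* (Q′G′²Q′*)⁻¹`** for gen 5's orthogonal projection `R` onto `ΔN(Q′)` (every hypothesis of
`starProjection_eq_repr217` discharged; `ΔN(Q′) = Δ′_aN(Q′)`: `KE_eq_map_deltaPE`), ***"Rf = Δλ = Δ′_aλ"*** (`RE_eq_lapE_lam216`);
**(2.13)/(2.12)**: `isMin213_iff` (`λ ∈ N(Q′)` minimises (2.13) over `N(Q′)` iff `Rf = Δλ`), `existsUnique_isMin213` (*"this
minimum"* exists and is unique, by (2.11)), `isMin213_iff_eq_lam216` (and it IS the `λ` of the chain), `eq213_V1`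
(`‖f − Rf‖ ≤ ‖f − Δ′_aμ‖`, `Δ′_aμ = Δμ` on `N(Q′)`).  §5 **(2.26)–(2.27)** `eq227_V1`/`eq226_V1` (`R = Δ𝒢Δ` with
`𝒢 = B6SectA.calG G′ Q′ Q′* (Q′G′²Q′*)⁻¹`), `calG_annihilate_V1` (*"Q′𝒢 = 𝒢Q′* = 0"*), `inner_calG_left_V1` (`𝒢` symmetric).
-/

open scoped InnerProductSpace

namespace Literature.MathematicalPhysics.QuantumFieldTheory.Balaban1983to89.B6Eq217ScalarModelV1

open LatticeFieldCalculus B6SectADomainsV1 B6SectAZeroModesV1 B6SectAOntoV1 B6SectAOperatorsV1 B6SectAVectorModelV1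
  B6SectACriticalPointV1 B6SectAScalarModelV1
open BalabanImbrieJaffe1984to88.BIJ85AxialPropagator411 (BondSpace PlaqSpace)

noncomputable section

variable {P : Params} (D : Domains P)


/-! ## §3. The Lagrange chain (2.15)–(2.16) -/

/-- **(2.15) `g(λ, ω) = ½‖f − Δ′_aλ‖² + ⟨ω, Q′λ⟩`** (ℓ² pairings). [cite: Balaban1984PropagatorsII, (2.15) p.225] -/
def g215 (c : ℝ) (w : SiteIdx D → ℝ) (f lam : ScalarSpace P) (ω : SiteIdxSpace D) : ℝ :=
  (1 / 2) * ‖f - deltaPE D c w lam‖ ^ 2 + ⟪ω, QpE D lam⟫_ℝ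

/-- the exact expansion of `g` in `λ`: first-order coefficient `⟨v, −Δ′_a(f − Δ′_aλ) + Q′*ω⟩` = the printed `δg/δλ` of (2.16).
[cite: Balaban1984PropagatorsII, (2.15)–(2.16) p.225] -/
theorem g215_add_lam (c : ℝ) (w : SiteIdx D → ℝ) (f lam v : ScalarSpace P) (ω : SiteIdxSpace D) :
    g215 D c w f (lam + v) ω = g215 D c w f lam ω +
      ⟪v, -(deltaPE D c w (f - deltaPE D c w lam)) + QpsE D ω⟫_ℝ + (1 / 2) * ‖deltaPE D c w v‖ ^ 2 := by
  have key : ∀ u e : ScalarSpace P, (1 / 2 : ℝ) * ‖u - e‖ ^ 2 = (1 / 2) * ‖u‖ ^ 2 - ⟪e, u⟫_ℝ + (1 / 2) * ‖e‖ ^ 2 := by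
    intro u e
    rw [← real_inner_self_eq_norm_sq (u - e), ← real_inner_self_eq_norm_sq u, ← real_inner_self_eq_norm_sq e,
      inner_sub_left, inner_sub_right, inner_sub_right, real_inner_comm u e]
    ring
  simp only [g215, map_add]
  have h : f - (deltaPE D c w lam + deltaPE D c w v) = (f - deltaPE D c w lam) - deltaPE D c w v := by abel
  rw [h, key (f - deltaPE D c w lam) (deltaPE D c w v), inner_add_right, inner_add_right, inner_neg_right,
    ← inner_deltaPE_left D c w v (f - _), ← inner_QpsE_left D ω v, real_inner_comm v (QpsE D ω)]
  ring

/-- the exact expansion of `g` in `ω`: it is affine with coefficient `⟨ν, Q′λ⟩` = the printed `δg/δω` of (2.16).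
[cite: Balaban1984PropagatorsII, (2.15)–(2.16) p.225] -/
theorem g215_add_omega (c : ℝ) (w : SiteIdx D → ℝ) (f lam : ScalarSpace P) (ω ν : SiteIdxSpace D) :
    g215 D c w f lam (ω + ν) = g215 D c w f lam ω + ⟪ν, QpE D lam⟫_ℝ := by
  simp only [g215, inner_add_left]
  ring

/-- **(2.16), the extremal equations of `g`**: `δg/δλ = −Δ′_a(f − Δ′_aλ) + Q′*ω = 0`, `δg/δω = Q′λ = 0`. [cite: Balaban1984PropagatorsII, (2.16) p.225] -/
def Eq216 (c : ℝ) (w : SiteIdx D → ℝ) (f lam : ScalarSpace P) (ω : SiteIdxSpace D) : Prop :=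
  -(deltaPE D c w (f - deltaPE D c w lam)) + QpsE D ω = 0 ∧ QpE D lam = 0

/-- `g` is stationary at `(λ, ω)` (both first-order coefficients of the exact expansions vanish identically) iff (2.16) holds
(*"Extremal points of this function are given by solutions of the equations (2.16)"*). [cite: Balaban1984PropagatorsII, (2.15)–(2.16) p.225] -/
theorem eq216_iff_stationary (c : ℝ) (w : SiteIdx D → ℝ) (f lam : ScalarSpace P) (ω : SiteIdxSpace D) :
    Eq216 D c w f lam ω ↔
      (∀ v : ScalarSpace P, ⟪v, -(deltaPE D c w (f - deltaPE D c w lam)) + QpsE D ω⟫_ℝ = 0) ∧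
        ∀ ν : SiteIdxSpace D, ⟪ν, QpE D lam⟫_ℝ = 0 := by
  refine ⟨fun ⟨h1, h2⟩ => ⟨fun v => by rw [h1, inner_zero_right], fun ν => by rw [h2, inner_zero_right]⟩,
    fun ⟨h1, h2⟩ => ⟨?_, ?_⟩⟩
  · exact inner_self_eq_zero.mp (h1 _)
  · exact inner_self_eq_zero.mp (h2 _)

/-- **`ω = (Q′G′²Q′*)⁻¹Q′G′f`** (p. 225 *"hence ω = (Q′G′²Q′*)⁻¹Q′G′f"*). [cite: Balaban1984PropagatorsII, (2.16)–(2.17) p.225] -/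
def omega216 {c : ℝ} (hc : c ≠ 0) {w : SiteIdx D → ℝ} (hw : ∀ i, 0 < w i) (f : ScalarSpace P) : SiteIdxSpace D :=
  CpE D hc hw (QpE D (GpE D hc hw f))

/-- **`λ = G′f − G′²Q′*(Q′G′²Q′*)⁻¹Q′G′f`** (p. 225). [cite: Balaban1984PropagatorsII, (2.16)–(2.17) p.225] -/
def lam216 {c : ℝ} (hc : c ≠ 0) {w : SiteIdx D → ℝ} (hw : ∀ i, 0 < w i) (f : ScalarSpace P) : ScalarSpace P :=
  GpE D hc hw f - GpE D hc hw (GpE D hc hw (QpsE D (omega216 D hc hw f)))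

/-- unfolding of `λ`. [cite: Balaban1984PropagatorsII, (2.17) p.225] -/
theorem lam216_def {c : ℝ} (hc : c ≠ 0) {w : SiteIdx D → ℝ} (hw : ∀ i, 0 < w i) (f : ScalarSpace P) :
    lam216 D hc hw f = GpE D hc hw f - GpE D hc hw (GpE D hc hw (QpsE D (CpE D hc hw (QpE D (GpE D hc hw f))))) := rfl

/-- ***"Of course Q′λ = 0"***: `λ ∈ N(Q′)`. [cite: Balaban1984PropagatorsII, (2.17) p.225] -/
theorem QpE_lam216 {c : ℝ} (hc : c ≠ 0) {w : SiteIdx D → ℝ} (hw : ∀ i, 0 < w i) (f : ScalarSpace P) :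
    QpE D (lam216 D hc hw f) = 0 := by
  have h := qggqpE_CpE D hc hw (QpE D (GpE D hc hw f))
  simp only [qggqpE, LinearMap.comp_apply] at h
  rw [lam216, omega216, map_sub, h, sub_self]

/-- `λ ∈ N(Q′)` as membership. [cite: Balaban1984PropagatorsII, (2.17) p.225] -/
theorem lam216_mem_ker {c : ℝ} (hc : c ≠ 0) {w : SiteIdx D → ℝ} (hw : ∀ i, 0 < w i) (f : ScalarSpace P) :
    lam216 D hc hw f ∈ LinearMap.ker (QpE D) :=
  LinearMap.mem_ker.mpr (QpE_lam216 D hc hw f)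

/-- **`Δ′_aλ = f − G′Q′*(Q′G′²Q′*)⁻¹Q′G′f`** = r03's `B6SectA.repr217 G′ Q′ Q′* (Q′G′²Q′*)⁻¹ f`. [cite: Balaban1984PropagatorsII, (2.17) p.225] -/
theorem deltaPE_lam216 {c : ℝ} (hc : c ≠ 0) {w : SiteIdx D → ℝ} (hw : ∀ i, 0 < w i) (f : ScalarSpace P) :
    deltaPE D c w (lam216 D hc hw f) = B6SectA.repr217 (GpE D hc hw) (QpE D) (QpsE D) (CpE D hc hw) f := by
  rw [lam216, omega216, map_sub, deltaPE_GpE, deltaPE_GpE]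
  simp [B6SectA.repr217]

/-- **(2.16) has EXACTLY the printed solution**: `(λ, ω)` solves (2.16) iff `ω = (Q′G′²Q′*)⁻¹Q′G′f` and
`λ = G′f − G′²Q′*(Q′G′²Q′*)⁻¹Q′G′f` (*"The first equation gives λ = Δ′_a⁻¹f − Δ′_a⁻²Q′*ω = G′f − G′²Q′*ω, from the second we get
Q′λ = Q′G′f − Q′G′²Q′*ω = 0, hence …"*). [cite: Balaban1984PropagatorsII, (2.16)–(2.17) p.225] -/
theorem eq216_iff {c : ℝ} (hc : c ≠ 0) {w : SiteIdx D → ℝ} (hw : ∀ i, 0 < w i) (f lam : ScalarSpace P)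
    (ω : SiteIdxSpace D) : Eq216 D c w f lam ω ↔ lam = lam216 D hc hw f ∧ ω = omega216 D hc hw f := by
  constructor
  · rintro ⟨h1, h2⟩
    -- "The first equation gives λ = G′f − G′²Q′*ω"
    have h1' : deltaPE D c w (f - deltaPE D c w lam) = QpsE D ω := neg_add_eq_zero.mp h1
    have hlam : lam = GpE D hc hw f - GpE D hc hw (GpE D hc hw (QpsE D ω)) := by
      have := congrArg (fun u => GpE D hc hw (GpE D hc hw u)) h1'
      simp only [GpE_deltaPE, map_sub] at this
      rw [← this, sub_sub_cancel]
    -- "from the second we get Q′λ = Q′G′f − Q′G′²Q′*ω = 0, hence ω = (Q′G′²Q′*)⁻¹Q′G′f"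
    have hω : ω = omega216 D hc hw f := by
      have hq : qggqpE D hc hw ω = QpE D (GpE D hc hw f) := by
        have h2' := h2
        rw [hlam, map_sub, sub_eq_zero] at h2'
        simpa [qggqpE] using h2'.symm
      rw [omega216, ← hq, CpE_qggqpE]
    refine ⟨?_, hω⟩
    rw [hlam, hω, lam216]
  · rintro ⟨rfl, rfl⟩
    refine ⟨?_, QpE_lam216 D hc hw f⟩
    rw [deltaPE_lam216, neg_add_eq_zero]
    simp only [B6SectA.repr217, LinearMap.sub_apply, LinearMap.id_apply, LinearMap.comp_apply, sub_sub_cancel,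
      deltaPE_GpE, omega216]

/-- hence (2.16) has exactly one solution. [cite: Balaban1984PropagatorsII, (2.16) p.225] -/
theorem existsUnique_eq216 {c : ℝ} (hc : c ≠ 0) {w : SiteIdx D → ℝ} (hw : ∀ i, 0 < w i) (f : ScalarSpace P) :
    ∃! p : ScalarSpace P × SiteIdxSpace D, Eq216 D c w f p.1 p.2 := by
  refine ⟨(lam216 D hc hw f, omega216 D hc hw f), (eq216_iff D hc hw f _ _).mpr ⟨rfl, rfl⟩, fun p hp => ?_⟩
  obtain ⟨h1, h2⟩ := (eq216_iff D hc hw f p.1 p.2).mp hp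
  exact Prod.ext h1 h2

/-! ## §4. (2.17) for the concrete orthogonal projection `R`, and the minimum (2.13) -/

/-- `ΔN(Q′) = Δ′_aN(Q′)` for the concrete operators (r03's `map_deltaPrime_ker_eq`). [cite: Balaban1984PropagatorsII, (2.13) p.225] -/
theorem KE_eq_map_deltaPE (c : ℝ) (w : SiteIdx D → ℝ) :
    KE D c = (B6SectA.gaugeSpace (QpE D)).map (deltaPE D c w) :=
  (B6SectA.map_deltaPrime_ker_eq (lapE c) (QpE D) (QpsE D) (apE D w)).symm

/-- **(2.17) PROVED for the concrete multi-level operators**: gen 5's `R` — *"an orthogonal projection in the space L²(T_η) onto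
the subspace ΔN(Q′)"* — EQUALS `I − G′Q′*(Q′G′²Q′*)⁻¹Q′G′` with `G′ = Δ′_a⁻¹` and `(Q′G′²Q′*)⁻¹` CONSTRUCTED, for every nested
family, `c ≠ 0`, `a > 0` (every hypothesis of r03's `B6SectA.starProjection_eq_repr217` discharged). [cite: Balaban1984PropagatorsII, (2.17) p.225] -/
theorem eq217_V1 {c : ℝ} (hc : c ≠ 0) {w : SiteIdx D → ℝ} (hw : ∀ i, 0 < w i) (f : ScalarSpace P) :
    RE D c f = B6SectA.repr217 (GpE D hc hw) (QpE D) (QpsE D) (CpE D hc hw) f := by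
  rw [RE_apply]
  exact B6SectA.starProjection_eq_repr217 (deltaPE D c w) (GpE D hc hw) (QpE D) (QpsE D) (CpE D hc hw)
    (inner_GpE_left D hc hw) (inner_QpsE_left D) (deltaPE_comp_GpE D hc hw) (GpE_comp_deltaPE D hc hw)
    (qggqpE_comp_CpE D hc hw) (KE D c) (KE_eq_map_deltaPE D c w) f

/-- (2.17) as an identity of operators on `L²(T_η)`. [cite: Balaban1984PropagatorsII, (2.17) p.225] -/
theorem eq217_op_V1 {c : ℝ} (hc : c ≠ 0) {w : SiteIdx D → ℝ} (hw : ∀ i, 0 < w i) :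
    RE D c = B6SectA.repr217 (GpE D hc hw) (QpE D) (QpsE D) (CpE D hc hw) :=
  LinearMap.ext (eq217_V1 D hc hw)

/-- ***"Rf = Δλ = Δ′_aλ"*** with the `λ` of the chain. [cite: Balaban1984PropagatorsII, (2.17) p.225] -/
theorem RE_eq_lapE_lam216 {c : ℝ} (hc : c ≠ 0) {w : SiteIdx D → ℝ} (hw : ∀ i, 0 < w i) (f : ScalarSpace P) :
    RE D c f = lapE c (lam216 D hc hw f) ∧ RE D c f = deltaPE D c w (lam216 D hc hw f) := by
  have h2 : RE D c f = deltaPE D c w (lam216 D hc hw f) := by rw [eq217_V1 D hc hw, deltaPE_lam216]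
  exact ⟨h2.trans (B6SectA.deltaPrime_apply_of_mem_ker _ _ _ _ (lam216_mem_ker D hc hw f)), h2⟩

/-- **(2.13), the minimum property**: `λ ∈ N(Q′)` minimises `μ ↦ ‖f − Δμ‖` over `N(Q′)` IFF `Rf = Δλ` (*"a value Rf of the
operator R … is equal to Δλ, where λ is a minimum of the functional (2.13)"*). [cite: Balaban1984PropagatorsII, (2.13) p.225] -/
theorem isMin213_iff (c : ℝ) (f lam : ScalarSpace P) (hlam : lam ∈ LinearMap.ker (QpE D)) :
    (∀ mu ∈ LinearMap.ker (QpE D), ‖f - lapE c lam‖ ≤ ‖f - lapE c mu‖) ↔ RE D c f = lapE c lam := by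
  have hmem : lapE c lam ∈ KE D c := Submodule.mem_map_of_mem hlam
  constructor
  · intro hmin
    set p := RE D c f with hp
    obtain ⟨mu, hmu, hmu'⟩ := RE_range D c f
    have hpmu : p = lapE c mu := hmu'
    have hle : ‖f - lapE c lam‖ ≤ ‖f - p‖ := by rw [hpmu]; exact hmin mu hmu
    have horth : ⟪f - p, p - lapE c lam⟫_ℝ = 0 :=
      Submodule.starProjection_inner_eq_zero f _ (Submodule.sub_mem _ (RE_mem D c f) hmem)
    have hdecomp : f - lapE c lam = (f - p) + (p - lapE c lam) := by abel
    have hpy : ‖f - lapE c lam‖ * ‖f - lapE c lam‖ = ‖f - p‖ * ‖f - p‖ + ‖p - lapE c lam‖ * ‖p - lapE c lam‖ := by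
      rw [hdecomp]; exact norm_add_sq_eq_norm_sq_add_norm_sq_of_inner_eq_zero _ _ horth
    have hc0 : ‖p - lapE c lam‖ * ‖p - lapE c lam‖ ≤ 0 := by nlinarith [norm_nonneg (f - lapE c lam), norm_nonneg (f - p)]
    have h00 : ‖p - lapE c lam‖ = 0 := by nlinarith [mul_self_nonneg ‖p - lapE c lam‖, norm_nonneg (p - lapE c lam)]
    exact sub_eq_zero.mp (norm_eq_zero.mp h00)
  · intro hR mu hmu
    have hv : lapE c mu ∈ KE D c := Submodule.mem_map_of_mem hmu
    set p := RE D c f with hp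
    have horth : ⟪f - p, p - lapE c mu⟫_ℝ = 0 :=
      Submodule.starProjection_inner_eq_zero f _ (Submodule.sub_mem _ (RE_mem D c f) hv)
    have hdecomp : f - lapE c mu = (f - p) + (p - lapE c mu) := by abel
    have hpy : ‖f - lapE c mu‖ * ‖f - lapE c mu‖ = ‖f - p‖ * ‖f - p‖ + ‖p - lapE c mu‖ * ‖p - lapE c mu‖ := by
      rw [hdecomp]; exact norm_add_sq_eq_norm_sq_add_norm_sq_of_inner_eq_zero _ _ horth
    rw [← hR]
    nlinarith [norm_nonneg (f - lapE c mu), norm_nonneg (f - p), norm_nonneg (p - lapE c mu)]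

/-- ***"this minimum"* exists and is unique**: for every `f` there is exactly one `λ ∈ N(Q′)` minimising (2.13) over `N(Q′)`
(existence: `Rf ∈ ΔN(Q′)`; uniqueness: `Δ` is injective on `N(Q′)`, gen 5's (2.11)). [cite: Balaban1984PropagatorsII, (2.11)–(2.13) p.225] -/
theorem existsUnique_isMin213 {c : ℝ} (hc : c ≠ 0) (f : ScalarSpace P) :
    ∃! lam : ScalarSpace P, lam ∈ LinearMap.ker (QpE D) ∧
      ∀ mu ∈ LinearMap.ker (QpE D), ‖f - lapE c lam‖ ≤ ‖f - lapE c mu‖ := by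
  obtain ⟨lam, hlam, hR0⟩ := RE_range D c f
  have hR : RE D c f = lapE c lam := hR0
  refine ⟨lam, ⟨hlam, (isMin213_iff D c f lam hlam).mpr hR⟩, fun lam' ⟨hlam', hmin'⟩ => ?_⟩
  have hR' := (isMin213_iff D c f lam' hlam').mp hmin'
  have hl : laplace c (WithLp.ofLp lam') = laplace c (WithLp.ofLp lam) := by
    rw [← ofLp_lapE, ← ofLp_lapE, ← hR', ← hR]
  exact WithLp.ofLp_injective 2
    (laplace_injOn_gaugeSpace D hc ((mem_ker_QpE_iff D _).mp hlam') ((mem_ker_QpE_iff D _).mp hlam) hl)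

/-- **the minimum of (2.13) IS the `λ` of the chain (2.16)**: `λ ∈ N(Q′)` minimises (2.13) iff
`λ = G′f − G′²Q′*(Q′G′²Q′*)⁻¹Q′G′f`. [cite: Balaban1984PropagatorsII, (2.13)–(2.17) p.225] -/
theorem isMin213_iff_eq_lam216 {c : ℝ} (hc : c ≠ 0) {w : SiteIdx D → ℝ} (hw : ∀ i, 0 < w i) (f lam : ScalarSpace P)
    (hlam : lam ∈ LinearMap.ker (QpE D)) :
    (∀ mu ∈ LinearMap.ker (QpE D), ‖f - lapE c lam‖ ≤ ‖f - lapE c mu‖) ↔ lam = lam216 D hc hw f := by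
  have hmin : ∀ mu ∈ LinearMap.ker (QpE D), ‖f - lapE c (lam216 D hc hw f)‖ ≤ ‖f - lapE c mu‖ :=
    (isMin213_iff D c f _ (lam216_mem_ker D hc hw f)).mpr (RE_eq_lapE_lam216 D hc hw f).1
  refine ⟨fun h => (existsUnique_isMin213 D hc f).unique ⟨hlam, h⟩ ⟨lam216_mem_ker D hc hw f, hmin⟩, ?_⟩
  rintro rfl
  exact hmin

/-- **(2.13) for the constructed operators**: `‖f − Rf‖ ≤ ‖f − Δ′_aμ‖` for every `μ ∈ N(Q′)`, and `Δ′_aμ = Δμ` there (r03's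
`norm_sub_repr217_le`/`deltaPrime_apply_of_mem_ker` discharged). [cite: Balaban1984PropagatorsII, (2.13) p.225] -/
theorem eq213_V1 {c : ℝ} (hc : c ≠ 0) {w : SiteIdx D → ℝ} (hw : ∀ i, 0 < w i) (f mu : ScalarSpace P)
    (hmu : mu ∈ LinearMap.ker (QpE D)) :
    ‖f - RE D c f‖ ≤ ‖f - deltaPE D c w mu‖ ∧ deltaPE D c w mu = lapE c mu := by
  refine ⟨?_, B6SectA.deltaPrime_apply_of_mem_ker _ _ _ _ hmu⟩
  rw [eq217_V1 D hc hw]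
  exact B6SectA.norm_sub_repr217_le (deltaPE D c w) (GpE D hc hw) (QpE D) (QpsE D) (CpE D hc hw)
    (inner_GpE_left D hc hw) (inner_QpsE_left D) (deltaPE_comp_GpE D hc hw) (GpE_comp_deltaPE D hc hw)
    (qggqpE_comp_CpE D hc hw) f hmu

/-! ## §5. (2.26)–(2.27): `R = Δ𝒢Δ`, `Q′𝒢 = 𝒢Q′* = 0` for the constructed `𝒢` -/

/-- **(2.27) ⇒ (2.17) algebra for the constructed operators**: with `𝒢 = G′² − G′²Q′*(Q′G′²Q′*)⁻¹Q′G′²` (`B6SectA.calG`) the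
(2.17) operator equals `Δ𝒢Δ` (r03's `deltaPrime_calG_deltaPrime` + `conj_calG_eq_lap_calG_lap`, inverse hypotheses
discharged). [cite: Balaban1984PropagatorsII, (2.26)–(2.27) pp.226–227] -/
theorem eq227_V1 {c : ℝ} (hc : c ≠ 0) {w : SiteIdx D → ℝ} (hw : ∀ i, 0 < w i) :
    B6SectA.repr217 (GpE D hc hw) (QpE D) (QpsE D) (CpE D hc hw) =
      lapE c ∘ₗ B6SectA.calG (GpE D hc hw) (QpE D) (QpsE D) (CpE D hc hw) ∘ₗ lapE c := by
  have h1 := B6SectA.conj_calG_eq_lap_calG_lap (lapE c) (GpE D hc hw) (QpE D) (QpsE D) (apE D w) (CpE D hc hw)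
    (qggqpE_comp_CpE D hc hw) (CpE_comp_qggqpE D hc hw)
  have h2 := B6SectA.deltaPrime_calG_deltaPrime (deltaPE D c w) (GpE D hc hw) (QpE D) (QpsE D) (CpE D hc hw)
    (deltaPE_comp_GpE D hc hw) (GpE_comp_deltaPE D hc hw)
  exact h2.symm.trans h1

/-- **(2.26) `R = Δ𝒢Δ`** for gen 5's orthogonal projection `R` onto `ΔN(Q′)` and the constructed `𝒢` of (2.27).
[cite: Balaban1984PropagatorsII, (2.26) p.226] -/
theorem eq226_V1 {c : ℝ} (hc : c ≠ 0) {w : SiteIdx D → ℝ} (hw : ∀ i, 0 < w i) :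
    RE D c = lapE c ∘ₗ B6SectA.calG (GpE D hc hw) (QpE D) (QpsE D) (CpE D hc hw) ∘ₗ lapE c := by
  rw [eq217_op_V1 D hc hw, eq227_V1 D hc hw]

/-- ***"the equalities Q′𝒢 = 𝒢Q′* = 0"*** for the constructed `𝒢`. [cite: Balaban1984PropagatorsII, p.227 after (2.27)] -/
theorem calG_annihilate_V1 {c : ℝ} (hc : c ≠ 0) {w : SiteIdx D → ℝ} (hw : ∀ i, 0 < w i) :
    QpE D ∘ₗ B6SectA.calG (GpE D hc hw) (QpE D) (QpsE D) (CpE D hc hw) = 0 ∧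
      B6SectA.calG (GpE D hc hw) (QpE D) (QpsE D) (CpE D hc hw) ∘ₗ QpsE D = 0 :=
  ⟨B6SectA.comp_tildeOp_eq_zero _ _ _ _ (qggqpE_comp_CpE D hc hw),
    B6SectA.tildeOp_comp_eq_zero _ _ _ _ (CpE_comp_qggqpE D hc hw)⟩

/-- `𝒢` is symmetric (for the Gaussian route of `…B6Eq226CovarianceMoments`). [cite: Balaban1984PropagatorsII, (2.27) p.227] -/
theorem inner_calG_left_V1 {c : ℝ} (hc : c ≠ 0) {w : SiteIdx D → ℝ} (hw : ∀ i, 0 < w i) (u v : ScalarSpace P) :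
    ⟪B6SectA.calG (GpE D hc hw) (QpE D) (QpsE D) (CpE D hc hw) u, v⟫_ℝ =
      ⟪u, B6SectA.calG (GpE D hc hw) (QpE D) (QpsE D) (CpE D hc hw) v⟫_ℝ :=
  B6SectA.inner_calG_comm _ _ _ _ (inner_GpE_left D hc hw) (inner_QpsE_left D) (inner_CpE_left D hc hw) u v

end

end Literature.MathematicalPhysics.QuantumFieldTheory.Balaban1983to89.B6Eq217ScalarModelV1
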